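import Summits.ValiantsHypothesis.ValiantsHypothesis.Theorems.LacunarySymmetroidMatrixDescartesVLawCoreTwo

/-!
# `MatrixDescartes` (stmt-ValiantsHypothesis-18050), line `Lift` — the STAR core lemma with same-side letters, part 2:
# positivity (`VLawCoreSameSide.core_pos₂`)

HONEST FRAMING.  Cell `pub-symmetroid`, seat `val-sym-mdr-p2` (gen 2); helper `--supports` the crux
`Theses.LacunarySymmetroid.MatrixDescartes`, NO closure claim.  Part 1 = `…VLawCoreTwo.lean` (same-side kernel
integrals, two-family entries, bookkeeping).  Consumed by `…FanLawTwo.lean`.  Nothing here bears on `stub_twoSided`,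
the crux in its window, `DoorA26`/`DoorA34`, or `VP ≠ VNP`.

`core_pos₂`: H-form `H(u) = J + (u^a)⁻¹ P + ∑ l, u^{b l} Q l + ∑ m, (u^{c m})⁻¹ R m` with `J` symmetric, `P, Q l, R m`
positive semidefinite, `0 < b l < a` (opposite side of the pivot, smaller gaps) and `a < c m < 2a` (same side as the
factoring letter `P`, gaps within a factor two; encoded `c m + b' m = 2a`, `0 < b' m`, `n' m + b' m + 1 = a`).  Kernel
vectors `v j` at pairwise distinct nodes `u j > 0`, a target `s > 0` off the nodes with every node's Rayleigh slope
`σ_j = −a(u_j^a)⁻¹P̂ + ∑ b_l u_j^{b_l} Q̂_l − ∑ c_m (u_j^{c_m})⁻¹ R̂_m` pointing towards `s` (`0 ≤ (s − u_j)σ_j`), and no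
`v j` killed by all letters ⇒ the quadratic form of `H(s)` is positive at every nonzero combination of the `v j`.
Proof = `…VLawCore.core_pos` with a second family of Gram blocks (kernel weight `ρ^{n'}·ρ^{2a}`).  [folklore]
-/

-- layout Summits/ValiantsHypothesis/ValiantsHypothesis forces the duplicated namespace component
set_option linter.dupNamespace false

namespace Summit.ValiantsHypothesis.ValiantsHypothesis.Theorems.LacunarySymmetroidMatrixDescartes

open MeasureTheory Set Filter Topology Matrix Finset
open scoped BigOperators
open VLawNormalForm VLawCore VLawCoreTwo

namespace VLawCoreSameSide

variable {ι : Type*} [Fintype ι] {κ μ : Type*} [Fintype κ] [Fintype μ]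

/-- **STAR CORE LEMMA with same-side letters.**  See the module docstring. [folklore] -/
theorem core_pos₂ [DecidableEq ι] (a : ℕ) (ha : 0 < a) (b n : κ → ℕ) (hnb : ∀ l, n l + b l + 1 = a)
    (hb : ∀ l, 0 < b l) (c n' b' : μ → ℕ) (hnb' : ∀ m, n' m + b' m + 1 = a) (hb' : ∀ m, 0 < b' m)
    (hc : ∀ m, c m + b' m = 2 * a)
    (J P : Matrix ι ι ℝ) (Q : κ → Matrix ι ι ℝ) (R : μ → Matrix ι ι ℝ) (hJ : J.IsSymm) (hP : P.PosSemidef)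
    (hQ : ∀ l, (Q l).PosSemidef) (hR : ∀ m, (R m).PosSemidef)
    {k : ℕ} (u : Fin k → ℝ) (hu : ∀ j, 0 < u j) (hinj : Function.Injective u) (v : Fin k → ι → ℝ)
    (hker : ∀ j, (J + ((u j) ^ a)⁻¹ • P + ∑ l, (u j) ^ (b l) • Q l + ∑ m, ((u j) ^ (c m))⁻¹ • R m) *ᵥ v j = 0)
    (s : ℝ) (hs : 0 < s) (hsu : ∀ j, s ≠ u j)
    (hstar : ∀ j, 0 ≤ (s - u j) * (-((a : ℝ) * ((u j) ^ a)⁻¹ * (v j ⬝ᵥ (P *ᵥ v j)))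
        + ∑ l, (b l : ℝ) * (u j) ^ (b l) * (v j ⬝ᵥ (Q l *ᵥ v j))
        - ∑ m, (c m : ℝ) * ((u j) ^ (c m))⁻¹ * (v j ⬝ᵥ (R m *ᵥ v j))))
    (hnd : ∀ j, ¬ (J *ᵥ v j = 0 ∧ P *ᵥ v j = 0 ∧ (∀ l, Q l *ᵥ v j = 0) ∧ ∀ m, R m *ᵥ v j = 0))
    (cc : Fin k → ℝ) (hcc : cc ≠ 0) :
    0 < (∑ j, cc j • v j) ⬝ᵥ
      ((J + (s ^ a)⁻¹ • P + ∑ l, s ^ (b l) • Q l + ∑ m, (s ^ (c m))⁻¹ • R m) *ᵥ ∑ j, cc j • v j) := by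
  classical
  have hna : ∀ l, n l + 2 ≤ a := fun l => by have := hnb l; have := hb l; omega
  have hna' : ∀ m, n' m + 2 ≤ a := fun m => by have := hnb' m; have := hb' m; omega
  have hPs : P.IsSymm := Matrix.isHermitian_iff_isSymm.1 hP.1
  have hQs : ∀ l, (Q l).IsSymm := fun l => Matrix.isHermitian_iff_isSymm.1 (hQ l).1
  have hRs : ∀ m, (R m).IsSymm := fun m => Matrix.isHermitian_iff_isSymm.1 (hR m).1
  have hw : ∀ j, 0 < ((u j) ^ a)⁻¹ := fun j => inv_pos.2 (pow_pos (hu j) a)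
  have ht : 0 < (s ^ a)⁻¹ := inv_pos.2 (pow_pos hs a)
  have hC : ∀ l, 0 < ∫ ρ in Ioi (0:ℝ), ρ ^ (n l) / (1 + ρ ^ a) :=
    fun l => VLawStieltjes.stieltjesConst_pos (hna l)
  have hC' : ∀ m, 0 < ∫ ρ in Ioi (0:ℝ), ρ ^ (n' m) / (1 + ρ ^ a) :=
    fun m => VLawStieltjes.stieltjesConst_pos (hna' m)
  have hwinj : Function.Injective fun j => ((u j) ^ a)⁻¹ := by
    intro i j h
    exact hinj ((pow_left_inj₀ (hu i).le (hu j).le ha.ne').1 (inv_injective h))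
  have hD : ∀ j, (s ^ a)⁻¹ - ((u j) ^ a)⁻¹ ≠ 0 := by
    intro j h
    exact hsu j ((pow_left_inj₀ hs.le (hu j).le ha.ne').1 (inv_injective (sub_eq_zero.1 h)))
  -- Step 1: bilinear expansion and the entrywise Stieltjes form
  rw [quadForm_sum_smul]
  have hentry : ∀ i j, v i ⬝ᵥ ((J + (s ^ a)⁻¹ • P + ∑ l, s ^ (b l) • Q l + ∑ m, (s ^ (c m))⁻¹ • R m) *ᵥ v j)
      = (∑ l, (v i ⬝ᵥ (Q l *ᵥ v j)) * (((s ^ a)⁻¹ - ((u i) ^ a)⁻¹) * ((s ^ a)⁻¹ - ((u j) ^ a)⁻¹)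
          * (∫ ρ in Ioi (0:ℝ), ρ ^ (n l) / (((u i) ^ a)⁻¹ + ρ ^ a)
              * ((((u j) ^ a)⁻¹ + ρ ^ a)⁻¹ * ((s ^ a)⁻¹ + ρ ^ a)⁻¹))
          / ∫ ρ in Ioi (0:ℝ), ρ ^ (n l) / (1 + ρ ^ a)))
        + (∑ m, (v i ⬝ᵥ (R m *ᵥ v j)) * (((s ^ a)⁻¹ - ((u i) ^ a)⁻¹) * ((s ^ a)⁻¹ - ((u j) ^ a)⁻¹)
          * (∫ ρ in Ioi (0:ℝ), ρ ^ (n' m) / ((s ^ a)⁻¹ + ρ ^ a)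
              * ((ρ ^ a * (((u i) ^ a)⁻¹ + ρ ^ a)⁻¹) * (ρ ^ a * (((u j) ^ a)⁻¹ + ρ ^ a)⁻¹)))
          / ∫ ρ in Ioi (0:ℝ), ρ ^ (n' m) / (1 + ρ ^ a)))
        + if i = j then ((s ^ a)⁻¹ - ((u i) ^ a)⁻¹) * (v i ⬝ᵥ (P *ᵥ v i)
            - ∑ l, ((b l : ℝ) / a) * (u i) ^ (a + b l) * (v i ⬝ᵥ (Q l *ᵥ v i))
            + ∑ m, ((c m : ℝ) / a) * (u i) ^ a * ((u i) ^ (c m))⁻¹ * (v i ⬝ᵥ (R m *ᵥ v i))) else 0 := by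
    intro i j
    by_cases hij : i = j
    · subst hij
      rw [if_pos rfl]
      exact entry_diag₂ ha hnb hb hnb' hb' hc J P Q R (hu i) hs (hker i)
    · rw [if_neg hij, add_zero]
      exact entry_offdiag₂ ha hnb hb hnb' hb' hc hJ hPs hQs hRs (hu i) (hu j) hs (fun h => hij (hinj h))
        (hker i) (hker j)
  simp_rw [hentry]
  rw [rearrange₂ cc (fun i => (s ^ a)⁻¹ - ((u i) ^ a)⁻¹)
    (fun i => ((s ^ a)⁻¹ - ((u i) ^ a)⁻¹) * (v i ⬝ᵥ (P *ᵥ v i)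
      - ∑ l, ((b l : ℝ) / a) * (u i) ^ (a + b l) * (v i ⬝ᵥ (Q l *ᵥ v i))
      + ∑ m, ((c m : ℝ) / a) * (u i) ^ a * ((u i) ^ (c m))⁻¹ * (v i ⬝ᵥ (R m *ᵥ v i))))
    (fun l i j => v i ⬝ᵥ (Q l *ᵥ v j))
    (fun l i j => ∫ ρ in Ioi (0:ℝ), ρ ^ (n l) / (((u i) ^ a)⁻¹ + ρ ^ a)
        * ((((u j) ^ a)⁻¹ + ρ ^ a)⁻¹ * ((s ^ a)⁻¹ + ρ ^ a)⁻¹))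
    (fun l => ∫ ρ in Ioi (0:ℝ), ρ ^ (n l) / (1 + ρ ^ a))
    (fun m i j => v i ⬝ᵥ (R m *ᵥ v j))
    (fun m i j => ∫ ρ in Ioi (0:ℝ), ρ ^ (n' m) / ((s ^ a)⁻¹ + ρ ^ a)
        * ((ρ ^ a * (((u i) ^ a)⁻¹ + ρ ^ a)⁻¹) * (ρ ^ a * (((u j) ^ a)⁻¹ + ρ ^ a)⁻¹)))
    (fun m => ∫ ρ in Ioi (0:ℝ), ρ ^ (n' m) / (1 + ρ ^ a))]
  -- Step 2: each Gram block is the integral of a nonnegative continuous function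
  set e : Fin k → ℝ := fun i => cc i * ((s ^ a)⁻¹ - ((u i) ^ a)⁻¹) with he_def
  have hblock : ∀ l, ∑ i, ∑ j, cc i * ((s ^ a)⁻¹ - ((u i) ^ a)⁻¹) * (cc j * ((s ^ a)⁻¹ - ((u j) ^ a)⁻¹))
      * (v i ⬝ᵥ (Q l *ᵥ v j))
      * (∫ ρ in Ioi (0:ℝ), ρ ^ (n l) / (((u i) ^ a)⁻¹ + ρ ^ a) * ((((u j) ^ a)⁻¹ + ρ ^ a)⁻¹ * ((s ^ a)⁻¹ + ρ ^ a)⁻¹))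
      = ∫ ρ in Ioi (0:ℝ), ∑ i, ∑ j, e i * e j * (v i ⬝ᵥ (Q l *ᵥ v j))
        * (ρ ^ (n l) / (((u i) ^ a)⁻¹ + ρ ^ a) * ((((u j) ^ a)⁻¹ + ρ ^ a)⁻¹ * ((s ^ a)⁻¹ + ρ ^ a)⁻¹)) :=
    fun l => (integral_quadForm (hna l) (fun i => ((u i) ^ a)⁻¹) hw ht (Q l) v e).symm
  have hblock' : ∀ m, ∑ i, ∑ j, cc i * ((s ^ a)⁻¹ - ((u i) ^ a)⁻¹) * (cc j * ((s ^ a)⁻¹ - ((u j) ^ a)⁻¹))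
      * (v i ⬝ᵥ (R m *ᵥ v j))
      * (∫ ρ in Ioi (0:ℝ), ρ ^ (n' m) / ((s ^ a)⁻¹ + ρ ^ a)
          * ((ρ ^ a * (((u i) ^ a)⁻¹ + ρ ^ a)⁻¹) * (ρ ^ a * (((u j) ^ a)⁻¹ + ρ ^ a)⁻¹)))
      = ∫ ρ in Ioi (0:ℝ), ∑ i, ∑ j, e i * e j * (v i ⬝ᵥ (R m *ᵥ v j))
        * (ρ ^ (n' m) / ((s ^ a)⁻¹ + ρ ^ a)
          * ((ρ ^ a * (((u i) ^ a)⁻¹ + ρ ^ a)⁻¹) * (ρ ^ a * (((u j) ^ a)⁻¹ + ρ ^ a)⁻¹))) :=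
    fun m => (integral_quadForm₂ (hna' m) (fun i => ((u i) ^ a)⁻¹) hw ht (R m) v e).symm
  have hnonneg : ∀ l (ρ : ℝ), 0 < ρ → 0 ≤ ∑ i, ∑ j, e i * e j * (v i ⬝ᵥ (Q l *ᵥ v j))
      * (ρ ^ (n l) / (((u i) ^ a)⁻¹ + ρ ^ a) * ((((u j) ^ a)⁻¹ + ρ ^ a)⁻¹ * ((s ^ a)⁻¹ + ρ ^ a)⁻¹)) := by
    intro l ρ hρ
    rw [quadForm_y]
    refine mul_nonneg (mul_nonneg (pow_nonneg hρ.le _) (VLawStieltjes.inv_den_le ht hρ.le).1) ?_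
    have h := (hQ l).dotProduct_mulVec_nonneg (∑ j, (e j * (((u j) ^ a)⁻¹ + ρ ^ a)⁻¹) • v j)
    rwa [star_trivial] at h
  have hnonneg' : ∀ m (ρ : ℝ), 0 < ρ → 0 ≤ ∑ i, ∑ j, e i * e j * (v i ⬝ᵥ (R m *ᵥ v j))
      * (ρ ^ (n' m) / ((s ^ a)⁻¹ + ρ ^ a)
        * ((ρ ^ a * (((u i) ^ a)⁻¹ + ρ ^ a)⁻¹) * (ρ ^ a * (((u j) ^ a)⁻¹ + ρ ^ a)⁻¹))) := by
    intro m ρ hρ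
    rw [quadForm_y₂]
    refine mul_nonneg (div_nonneg (pow_nonneg hρ.le _) (VLawStieltjes.den_pos ht a hρ.le).le) ?_
    have h := (hR m).dotProduct_mulVec_nonneg (∑ j, (e j * (ρ ^ a * (((u j) ^ a)⁻¹ + ρ ^ a)⁻¹)) • v j)
    rwa [star_trivial] at h
  have hint_nonneg : ∀ l, 0 ≤ ∫ ρ in Ioi (0:ℝ), ∑ i, ∑ j, e i * e j * (v i ⬝ᵥ (Q l *ᵥ v j))
      * (ρ ^ (n l) / (((u i) ^ a)⁻¹ + ρ ^ a) * ((((u j) ^ a)⁻¹ + ρ ^ a)⁻¹ * ((s ^ a)⁻¹ + ρ ^ a)⁻¹)) :=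
    fun l => setIntegral_nonneg measurableSet_Ioi fun ρ hρ => hnonneg l ρ hρ
  have hint_nonneg' : ∀ m, 0 ≤ ∫ ρ in Ioi (0:ℝ), ∑ i, ∑ j, e i * e j * (v i ⬝ᵥ (R m *ᵥ v j))
      * (ρ ^ (n' m) / ((s ^ a)⁻¹ + ρ ^ a)
        * ((ρ ^ a * (((u i) ^ a)⁻¹ + ρ ^ a)⁻¹) * (ρ ^ a * (((u j) ^ a)⁻¹ + ρ ^ a)⁻¹))) :=
    fun m => setIntegral_nonneg measurableSet_Ioi fun ρ hρ => hnonneg' m ρ hρ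
  -- Step 3: the slack terms are nonnegative (STAR)
  have hslack_eq : ∀ i, v i ⬝ᵥ (P *ᵥ v i) - ∑ l, ((b l : ℝ) / a) * (u i) ^ (a + b l) * (v i ⬝ᵥ (Q l *ᵥ v i))
        + ∑ m, ((c m : ℝ) / a) * (u i) ^ a * ((u i) ^ (c m))⁻¹ * (v i ⬝ᵥ (R m *ᵥ v i))
      = -((u i) ^ a / a) * (-((a : ℝ) * ((u i) ^ a)⁻¹ * (v i ⬝ᵥ (P *ᵥ v i)))
          + ∑ l, (b l : ℝ) * (u i) ^ (b l) * (v i ⬝ᵥ (Q l *ᵥ v i))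
          - ∑ m, (c m : ℝ) * ((u i) ^ (c m))⁻¹ * (v i ⬝ᵥ (R m *ᵥ v i))) := by
    intro i
    have ha0 : (a : ℝ) ≠ 0 := by exact_mod_cast ha.ne'
    have hu0 : (u i) ^ a ≠ 0 := (pow_pos (hu i) a).ne'
    rw [mul_sub, mul_add, Finset.mul_sum, Finset.mul_sum, sub_eq_add_neg, ← Finset.sum_neg_distrib,
      sub_eq_add_neg, ← Finset.sum_neg_distrib]
    congr 1
    · congr 1
      · field_simp
      · refine Finset.sum_congr rfl fun l _ => ?_
        rw [pow_add]
        field_simp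
    · refine Finset.sum_congr rfl fun m _ => ?_
      field_simp
  have hslack : ∀ i, 0 ≤ ((s ^ a)⁻¹ - ((u i) ^ a)⁻¹) * (v i ⬝ᵥ (P *ᵥ v i)
      - ∑ l, ((b l : ℝ) / a) * (u i) ^ (a + b l) * (v i ⬝ᵥ (Q l *ᵥ v i))
      + ∑ m, ((c m : ℝ) / a) * (u i) ^ a * ((u i) ^ (c m))⁻¹ * (v i ⬝ᵥ (R m *ᵥ v i))) := by
    intro i
    rw [hslack_eq]
    have h := weight_sign (a := a) hs (hu i) (hstar i)
    have hpos : 0 ≤ (u i) ^ a / a := div_nonneg (pow_nonneg (hu i).le a) (Nat.cast_nonneg a)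
    have : ((s ^ a)⁻¹ - ((u i) ^ a)⁻¹) * (-((u i) ^ a / a) * (-((a : ℝ) * ((u i) ^ a)⁻¹ * (v i ⬝ᵥ (P *ᵥ v i)))
          + ∑ l, (b l : ℝ) * (u i) ^ (b l) * (v i ⬝ᵥ (Q l *ᵥ v i))
          - ∑ m, (c m : ℝ) * ((u i) ^ (c m))⁻¹ * (v i ⬝ᵥ (R m *ᵥ v i))))
        = ((u i) ^ a / a) * ((((u i) ^ a)⁻¹ - (s ^ a)⁻¹) * (-((a : ℝ) * ((u i) ^ a)⁻¹ * (v i ⬝ᵥ (P *ᵥ v i)))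
          + ∑ l, (b l : ℝ) * (u i) ^ (b l) * (v i ⬝ᵥ (Q l *ᵥ v i))
          - ∑ m, (c m : ℝ) * ((u i) ^ (c m))⁻¹ * (v i ⬝ᵥ (R m *ᵥ v i)))) := by ring
    rw [this]
    exact mul_nonneg hpos h
  -- Step 4: nonnegativity of the whole form, and strictness by contradiction
  have hAterm : ∀ l, 0 ≤ (∫ ρ in Ioi (0:ℝ), ρ ^ (n l) / (1 + ρ ^ a))⁻¹ *
      ∑ i, ∑ j, cc i * ((s ^ a)⁻¹ - ((u i) ^ a)⁻¹) * (cc j * ((s ^ a)⁻¹ - ((u j) ^ a)⁻¹))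
        * (v i ⬝ᵥ (Q l *ᵥ v j))
        * (∫ ρ in Ioi (0:ℝ), ρ ^ (n l) / (((u i) ^ a)⁻¹ + ρ ^ a)
            * ((((u j) ^ a)⁻¹ + ρ ^ a)⁻¹ * ((s ^ a)⁻¹ + ρ ^ a)⁻¹)) := fun l => by
    rw [hblock l]; exact mul_nonneg (inv_nonneg.2 (hC l).le) (hint_nonneg l)
  have hAterm' : ∀ m, 0 ≤ (∫ ρ in Ioi (0:ℝ), ρ ^ (n' m) / (1 + ρ ^ a))⁻¹ *
      ∑ i, ∑ j, cc i * ((s ^ a)⁻¹ - ((u i) ^ a)⁻¹) * (cc j * ((s ^ a)⁻¹ - ((u j) ^ a)⁻¹))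
        * (v i ⬝ᵥ (R m *ᵥ v j))
        * (∫ ρ in Ioi (0:ℝ), ρ ^ (n' m) / ((s ^ a)⁻¹ + ρ ^ a)
            * ((ρ ^ a * (((u i) ^ a)⁻¹ + ρ ^ a)⁻¹) * (ρ ^ a * (((u j) ^ a)⁻¹ + ρ ^ a)⁻¹))) := fun m => by
    rw [hblock' m]; exact mul_nonneg (inv_nonneg.2 (hC' m).le) (hint_nonneg' m)
  have hA : 0 ≤ ∑ l, (∫ ρ in Ioi (0:ℝ), ρ ^ (n l) / (1 + ρ ^ a))⁻¹ *
      ∑ i, ∑ j, cc i * ((s ^ a)⁻¹ - ((u i) ^ a)⁻¹) * (cc j * ((s ^ a)⁻¹ - ((u j) ^ a)⁻¹))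
        * (v i ⬝ᵥ (Q l *ᵥ v j))
        * (∫ ρ in Ioi (0:ℝ), ρ ^ (n l) / (((u i) ^ a)⁻¹ + ρ ^ a)
            * ((((u j) ^ a)⁻¹ + ρ ^ a)⁻¹ * ((s ^ a)⁻¹ + ρ ^ a)⁻¹)) :=
    Finset.sum_nonneg fun l _ => hAterm l
  have hA' : 0 ≤ ∑ m, (∫ ρ in Ioi (0:ℝ), ρ ^ (n' m) / (1 + ρ ^ a))⁻¹ *
      ∑ i, ∑ j, cc i * ((s ^ a)⁻¹ - ((u i) ^ a)⁻¹) * (cc j * ((s ^ a)⁻¹ - ((u j) ^ a)⁻¹))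
        * (v i ⬝ᵥ (R m *ᵥ v j))
        * (∫ ρ in Ioi (0:ℝ), ρ ^ (n' m) / ((s ^ a)⁻¹ + ρ ^ a)
            * ((ρ ^ a * (((u i) ^ a)⁻¹ + ρ ^ a)⁻¹) * (ρ ^ a * (((u j) ^ a)⁻¹ + ρ ^ a)⁻¹))) :=
    Finset.sum_nonneg fun m _ => hAterm' m
  have hB : 0 ≤ ∑ i, cc i ^ 2 * (((s ^ a)⁻¹ - ((u i) ^ a)⁻¹) * (v i ⬝ᵥ (P *ᵥ v i)
      - ∑ l, ((b l : ℝ) / a) * (u i) ^ (a + b l) * (v i ⬝ᵥ (Q l *ᵥ v i))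
      + ∑ m, ((c m : ℝ) / a) * (u i) ^ a * ((u i) ^ (c m))⁻¹ * (v i ⬝ᵥ (R m *ᵥ v i)))) :=
    Finset.sum_nonneg fun i _ => mul_nonneg (sq_nonneg _) (hslack i)
  refine lt_of_le_of_ne (add_nonneg (add_nonneg hA hA') hB) fun hzero => ?_
  have hA0 := le_antisymm (by linarith) hA
  have hA0' := le_antisymm (by linarith) hA'
  have hB0 := le_antisymm (by linarith) hB
  obtain ⟨i₀, hi₀⟩ := Function.ne_iff.1 hcc
  have he₀ : e i₀ ≠ 0 := mul_ne_zero hi₀ (hD i₀)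
  -- every `Q l` kills `v i₀`
  have hQv : ∀ l, Q l *ᵥ v i₀ = 0 := by
    intro l
    have hl0 := (Finset.sum_eq_zero_iff_of_nonneg fun l _ => hAterm l).1 hA0 l (Finset.mem_univ l)
    rw [hblock l, mul_eq_zero] at hl0
    have hI : ∫ ρ in Ioi (0:ℝ), ∑ i, ∑ j, e i * e j * (v i ⬝ᵥ (Q l *ᵥ v j))
        * (ρ ^ (n l) / (((u i) ^ a)⁻¹ + ρ ^ a) * ((((u j) ^ a)⁻¹ + ρ ^ a)⁻¹ * ((s ^ a)⁻¹ + ρ ^ a)⁻¹)) = 0 :=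
      hl0.resolve_left (inv_ne_zero (hC l).ne')
    have hvan := eq_zero_of_integral_eq_zero
      (continuousOn_kernelSum (n l) a hw ht (fun i j => v i ⬝ᵥ (Q l *ᵥ v j)) e) (hnonneg l)
      (integrable_finsetSum _ fun i _ => integrable_finsetSum _ fun j _ =>
        integrableOn_kernel_term (hna l) (hw i) (hw j) ht _) hI
    have hQy : ∀ ρ : ℝ, 0 < ρ → ∑ i, (((u i) ^ a)⁻¹ + ρ ^ a)⁻¹ • (e i • (Q l *ᵥ v i)) = 0 := by
      intro ρ hρ
      have h0 := hvan ρ hρ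
      rw [quadForm_y, mul_eq_zero] at h0
      have h1 : (∑ i, (e i * (((u i) ^ a)⁻¹ + ρ ^ a)⁻¹) • v i)
          ⬝ᵥ (Q l *ᵥ ∑ j, (e j * (((u j) ^ a)⁻¹ + ρ ^ a)⁻¹) • v j) = 0 :=
        h0.resolve_left (mul_ne_zero (pow_pos hρ _).ne' (inv_ne_zero (VLawStieltjes.den_pos ht a hρ.le).ne'))
      have h2 := ((hQ l).dotProduct_mulVec_zero_iff (∑ j, (e j * (((u j) ^ a)⁻¹ + ρ ^ a)⁻¹) • v j)).1
        (by rwa [star_trivial])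
      rw [mulVec_sum] at h2
      rw [← h2]
      refine Finset.sum_congr rfl fun i _ => ?_
      rw [mulVec_smul, smul_smul, mul_comm]
    have hβ := eq_zero_of_sum_inv_smul_eq_zero ha (fun i => ((u i) ^ a)⁻¹) hw hwinj
      (fun i => e i • (Q l *ᵥ v i)) hQy i₀
    exact (smul_eq_zero.1 hβ).resolve_left he₀
  -- every `R m` kills `v i₀`
  have hRv : ∀ m, R m *ᵥ v i₀ = 0 := by
    intro m
    have hl0 := (Finset.sum_eq_zero_iff_of_nonneg fun m _ => hAterm' m).1 hA0' m (Finset.mem_univ m)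
    rw [hblock' m, mul_eq_zero] at hl0
    have hI : ∫ ρ in Ioi (0:ℝ), ∑ i, ∑ j, e i * e j * (v i ⬝ᵥ (R m *ᵥ v j))
        * (ρ ^ (n' m) / ((s ^ a)⁻¹ + ρ ^ a)
          * ((ρ ^ a * (((u i) ^ a)⁻¹ + ρ ^ a)⁻¹) * (ρ ^ a * (((u j) ^ a)⁻¹ + ρ ^ a)⁻¹))) = 0 :=
      hl0.resolve_left (inv_ne_zero (hC' m).ne')
    have hvan := eq_zero_of_integral_eq_zero
      (continuousOn_kernelSum₂ (n' m) a hw ht (fun i j => v i ⬝ᵥ (R m *ᵥ v j)) e) (hnonneg' m)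
      (integrable_finsetSum _ fun i _ => integrable_finsetSum _ fun j _ =>
        integrableOn_kernel_term₂ (hna' m) (hw i) (hw j) ht _) hI
    have hRy : ∀ ρ : ℝ, 0 < ρ → ∑ i, (((u i) ^ a)⁻¹ + ρ ^ a)⁻¹ • (e i • (R m *ᵥ v i)) = 0 := by
      intro ρ hρ
      have hρa : ρ ^ a ≠ 0 := (pow_pos hρ a).ne'
      have h0 := hvan ρ hρ
      rw [quadForm_y₂, mul_eq_zero] at h0
      have h1 : (∑ i, (e i * (ρ ^ a * (((u i) ^ a)⁻¹ + ρ ^ a)⁻¹)) • v i)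
          ⬝ᵥ (R m *ᵥ ∑ j, (e j * (ρ ^ a * (((u j) ^ a)⁻¹ + ρ ^ a)⁻¹)) • v j) = 0 :=
        h0.resolve_left (div_pos (pow_pos hρ _) (VLawStieltjes.den_pos ht a hρ.le)).ne'
      have h2 := ((hR m).dotProduct_mulVec_zero_iff
        (∑ j, (e j * (ρ ^ a * (((u j) ^ a)⁻¹ + ρ ^ a)⁻¹)) • v j)).1 (by rwa [star_trivial])
      rw [mulVec_sum] at h2
      have h3 : ρ ^ a • ∑ i, (((u i) ^ a)⁻¹ + ρ ^ a)⁻¹ • (e i • (R m *ᵥ v i)) = 0 := by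
        rw [Finset.smul_sum, ← h2]
        refine Finset.sum_congr rfl fun i _ => ?_
        rw [mulVec_smul, smul_smul, smul_smul]
        congr 1
        ring
      exact (smul_eq_zero.1 h3).resolve_left hρa
    have hβ := eq_zero_of_sum_inv_smul_eq_zero ha (fun i => ((u i) ^ a)⁻¹) hw hwinj
      (fun i => e i • (R m *ᵥ v i)) hRy i₀
    exact (smul_eq_zero.1 hβ).resolve_left he₀
  -- the slack at `i₀` vanishes, hence `P v i₀ = 0`
  have hPv : P *ᵥ v i₀ = 0 := by
    have hs0 := (Finset.sum_eq_zero_iff_of_nonneg fun i _ => mul_nonneg (sq_nonneg (cc i)) (hslack i)).1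
      hB0 i₀ (Finset.mem_univ i₀)
    have hQ0 : ∀ l, v i₀ ⬝ᵥ (Q l *ᵥ v i₀) = 0 := fun l => by rw [hQv l, dotProduct_zero]
    have hR0 : ∀ m, v i₀ ⬝ᵥ (R m *ᵥ v i₀) = 0 := fun m => by rw [hRv m, dotProduct_zero]
    simp_rw [hQ0, hR0, mul_zero, Finset.sum_const_zero, sub_zero, add_zero] at hs0
    rw [mul_eq_zero, mul_eq_zero] at hs0
    rcases hs0 with h | h | h
    · exact absurd (pow_eq_zero_iff two_ne_zero |>.1 h) hi₀
    · exact absurd h (hD i₀)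
    · exact (hP.dotProduct_mulVec_zero_iff (v i₀)).1 (by rwa [star_trivial])
  -- the kernel relation then gives `J v i₀ = 0`: contradiction with nondegeneracy
  have hJv : J *ᵥ v i₀ = 0 := by
    have h := hker i₀
    rw [add_mulVec, add_mulVec, add_mulVec, smul_mulVec, hPv, smul_zero, add_zero, Matrix.sum_mulVec,
      Finset.sum_eq_zero (fun l _ => by rw [smul_mulVec, hQv l, smul_zero]), add_zero, Matrix.sum_mulVec,
      Finset.sum_eq_zero (fun m _ => by rw [smul_mulVec, hRv m, smul_zero]), add_zero] at h
    exact h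
  exact hnd i₀ ⟨hJv, hPv, hQv, hRv⟩

end VLawCoreSameSide

end Summit.ValiantsHypothesis.ValiantsHypothesis.Theorems.LacunarySymmetroidMatrixDescartes
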